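import Mathlib
import Summits.KontsevichZagierPeriods.Zeta5Search.BrickKernelHatTwo
import Summits.KontsevichZagierPeriods.Zeta5Search.BrickFrobeniusTwoOddRow

/-!
# BrickHatTwoCells — the HAT identity at the prime `2` on the cells: the Laurent cells of the centre-free brick kernel at an ODD
pole `2K+1` of an EVEN row `2N+2` (a hole of the digit split) against the cells at the pole `K` of the row `N`:
`2^d·laurent(2N+2, 2K+1, d) = 2^A·Σ_{m+e=d} h_m·laurent(N, K, e)`, `h_m ∈ ℤ_(2)` (cell `pub-zeta5`, seat ct-1 g42)

HONEST FRAMING: systematic search; no irrationality claim unless certified.  INSTRUMENT identities/valuations about the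
Laurent coefficients `laurent A B 0 n K d` (`BrickLaurent`) of the centre-free brick kernel; nothing about `ζ(5)`/`ζ(3)`; no
`γ`/record statement; records in print UNMOVED; NOTHING IS DISCHARGED (net named-fact debt 0).

WHY: with `BrickFrobeniusAllPrimes` (even poles of even rows), `BrickFrobeniusTwoOddRow{,Even}` (odd rows) this is the fourth
and last pole type at `p = 2`: the HOLES `(2N+2, 2K+1)`.  `BrickHoleCellsAllPrimes` bounds them by `O(2^A)`, enough while
`L + 1 ≤ A`; to run a level induction at EVERY level (as `BrickLevelReductionInf` does for odd `p` with `G = p^A·γ`) one needs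
the exact reduction to the row `N`, which `BrickKernelHatTwo.brickKernel_two_even_row_odd` provides; this file turns it into
the cell identity with `H(T) := Ĥ_N(−K+T)·((T−K−N−1)(T−K+2N+1))^B = N_H(T)/D_H(T)` written out as polynomials:

* `topFun_two_even_row_odd` — `g^{(2N+2)}_{2K+1}(2t−1) = 2^A·Ĥ_N(t)·((t−N−1)(t+2N+1))^B·g^{(N)}_K(t)` (`t ≠ −K`);
* `eval_hatDen_ne_zero`, `hat_eval`, `frobenius_poly_two_hat`;
* **`laurentSeries_two_hat`** — `rescale₂(F^{(2N+2)}_{2K+1}) = C(2^A)·(N_H/D_H)·F^{(N)}_K`;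
* **`laurent_two_hat`** — `2^d·laurent(2N+2, 2K+1, d) = 2^A·Σ_{(m,e) ∈ antidiagonal d} h_m·laurent(N, K, e)`; **`cell_two_hat`**;
* **`isSlopeInt_hatSeries`** — `h_m ∈ ℤ_(2)` (`isSlopeInt_hatNum`, `isSlopeInt_hatDen`, `padicValuation_constantCoeff_hatDen`),
  and **`padicValuation_pow_mul_laurent_two_hat`**: `v₂(2^d·laurent(2N+2,2K+1,d)) ≤ 2^{−A}·max_e v₂(laurent(N,K,e))` — the hole
  cells are `2^A` times `2`-integral data on the row `N` (the `p = 2` hole weight is `G = 2^A·γ`).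

Theorems only (0 `def`); tree vocabulary; nothing restated.
-/

namespace Summit.KontsevichZagierPeriods.Zeta5Search.BrickHatTwoCells

open Finset Nat Polynomial WithZero
open Summit.KontsevichZagierPeriods.Zeta5Search.BrickKernelFrobenius (brickKernel)
open Summit.KontsevichZagierPeriods.Zeta5Search.BrickTopCoefficient (topFun brickKernel_mul_pow)
open Summit.KontsevichZagierPeriods.Zeta5Search.BrickKernelHatTwo (brickKernel_two_even_row_odd)
open Summit.KontsevichZagierPeriods.Zeta5Search.BrickFrobeniusTwoOddRow (odd_add_two_mul_ne_zero isSlopeInt_two_linear)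
open Summit.KontsevichZagierPeriods.Zeta5Search.BrickLaurent (expandAt laurentSeries laurent cell kerNum kerDenErase
  topFun_eq_div eval_kerDenErase_neg_ne_zero coe_comp_C_mul_X rescale_inv constantCoeff_coe_taylor)
open Summit.KontsevichZagierPeriods.Zeta5Search.ScaledSeries (IsSlopeInt isSlopeInt_mul isSlopeInt_C isSlopeInt_mono_left)
open Summit.KontsevichZagierPeriods.Zeta5Search.BrickPhiCoeff (isSlopeInt_coe_map_int isSlopeInt_inv)
open Summit.KontsevichZagierPeriods.Zeta5Search.BrickPhiAllPrimes (isSlopeInt_coe_C_add_C_mul_X isSlopeInt_coe_prod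
  isSlopeInt_coe_pow)

noncomputable section

/-! ## The regular parts -/

/-- **Regular parts on an even row, odd pole (hole)**: for `2B ≤ A`, `K ≤ N`, `t ≠ −K`:
`g^{(2N+2)}_{2K+1}(2t−1) = 2^A·Ĥ_N(t)·((t−N−1)(t+2N+1))^B·g^{(N)}_K(t)` (`topFun`; from `brickKernel_two_even_row_odd` and
`(2t−1) + (2K+1) = 2(t+K)`). -/
theorem topFun_two_even_row_odd {A B : ℕ} (hAB : 2 * B ≤ A) {N K : ℕ} (hK : K ≤ N) {t : ℚ} (ht : t + K ≠ 0) :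
    topFun A B 0 (2 * N + 2) (2 * K + 1) (2 * t - 1) =
      (2 : ℚ) ^ A * ((((N : ℚ) + 1) * ∏ i ∈ range (N + 1), (2 * (i : ℚ) + 1)) ^ (A - 2 * B) *
          ((∏ i ∈ Icc 1 (N + 1), (2 * t - 2 * i - 1)) * ∏ i ∈ Icc 1 (N + 1), (2 * t + 2 * N + 2 * i + 1)) ^ B /
          (∏ i ∈ range (N + 1 + 1), (2 * t + 2 * i - 1)) ^ A * ((t - N - 1) * (t + 2 * N + 1)) ^ B) *
        topFun A B 0 N K t := by
  have h1 : (2 * t - 1) + ((2 * K + 1 : ℕ) : ℚ) ≠ 0 := by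
    push_cast; intro h; apply ht; linarith
  rw [← brickKernel_mul_pow A B 0 (by omega : 2 * K + 1 ≤ 2 * N + 2) h1, ← brickKernel_mul_pow A B 0 hK ht,
    brickKernel_two_even_row_odd (K := ℚ) hAB two_ne_zero N t]
  have e : (2 * t - 1 + ((2 * K + 1 : ℕ) : ℚ)) ^ A = (2 : ℚ) ^ A * (t + K) ^ A := by
    rw [← mul_pow]; congr 1; push_cast; ring
  rw [e]
  ring

/-! ## `H(T) = Ĥ_N(−K+T)·((T−K−N−1)(T−K+2N+1))^B` as a quotient of polynomials -/

section poly

variable (A B N K : ℕ)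

/-- `D_H(T₀) ≠ 0` for every integer `T₀`: all factors `(2i−1−2K) + 2T₀` are odd. -/
theorem eval_hatDen_ne_zero (T₀ : ℤ) :
    ((∏ i ∈ range (N + 1 + 1), (C (2 * (i : ℚ) - 1 - 2 * K) + C (2 : ℚ) * X)) ^ A).eval (T₀ : ℚ) ≠ 0 := by
  rw [eval_pow, eval_prod]
  refine pow_ne_zero _ (Finset.prod_ne_zero_iff.2 fun i _ => ?_)
  rw [eval_add, eval_mul, eval_C, eval_C, eval_X]
  have h := odd_add_two_mul_ne_zero (c := 2 * (i : ℤ) - 1 - 2 * K) ⟨(i : ℤ) - K - 1, by ring⟩ T₀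
  push_cast at h
  exact h

/-- **`N_H(T)/D_H(T) = Ĥ_N(−K+T)·((T−K−N−1)(T−K+2N+1))^B`** for every `T`. -/
theorem hat_eval (T : ℚ) :
    (C ((((N : ℚ) + 1) * ∏ i ∈ range (N + 1), (2 * (i : ℚ) + 1)) ^ (A - 2 * B)) *
        ((∏ i ∈ Icc 1 (N + 1), (C (-(2 * (K : ℚ)) - 2 * i - 1) + C (2 : ℚ) * X)) *
          ∏ i ∈ Icc 1 (N + 1), (C (-(2 * (K : ℚ)) + 2 * N + 2 * i + 1) + C (2 : ℚ) * X)) ^ B *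
        ((X - C ((K : ℚ) + N + 1)) * (X + C (((2 * N + 1 : ℕ) : ℚ) - K))) ^ B).eval T /
      ((∏ i ∈ range (N + 1 + 1), (C (2 * (i : ℚ) - 1 - 2 * K) + C (2 : ℚ) * X)) ^ A).eval T =
    (((N : ℚ) + 1) * ∏ i ∈ range (N + 1), (2 * (i : ℚ) + 1)) ^ (A - 2 * B) *
        ((∏ i ∈ Icc 1 (N + 1), (2 * (-(K : ℚ) + T) - 2 * i - 1)) *
          ∏ i ∈ Icc 1 (N + 1), (2 * (-(K : ℚ) + T) + 2 * N + 2 * i + 1)) ^ B /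
        (∏ i ∈ range (N + 1 + 1), (2 * (-(K : ℚ) + T) + 2 * i - 1)) ^ A *
        ((-(K : ℚ) + T - N - 1) * (-(K : ℚ) + T + 2 * N + 1)) ^ B := by
  simp only [eval_mul, eval_pow, eval_prod, eval_add, eval_sub, eval_C, eval_X]
  have h1 : ∏ i ∈ Icc 1 (N + 1), (-(2 * (K : ℚ)) - 2 * i - 1 + 2 * T) = ∏ i ∈ Icc 1 (N + 1), (2 * (-(K : ℚ) + T) - 2 * i - 1) :=
    Finset.prod_congr rfl fun i _ => by ring
  have h2 : ∏ i ∈ Icc 1 (N + 1), (-(2 * (K : ℚ)) + 2 * N + 2 * i + 1 + 2 * T) =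
      ∏ i ∈ Icc 1 (N + 1), (2 * (-(K : ℚ) + T) + 2 * N + 2 * i + 1) :=
    Finset.prod_congr rfl fun i _ => by ring
  have h3 : ∏ i ∈ range (N + 1 + 1), (2 * (i : ℚ) - 1 - 2 * K + 2 * T) =
      ∏ i ∈ range (N + 1 + 1), (2 * (-(K : ℚ) + T) + 2 * i - 1) :=
    Finset.prod_congr rfl fun i _ => by ring
  rw [h1, h2, h3]
  push_cast
  ring

end poly

/-! ## The polynomial identity and the hat identity on the cells -/

section frobenius

variable {A B : ℕ} (hAB : 2 * B ≤ A) {N K : ℕ} (hK : K ≤ N)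
include hAB hK

/-- The polynomial identity behind the hat: with `L_N = taylor_{−(2K+1)}(kerNum_{2N+2})(2T)`,
`L_D = taylor_{−(2K+1)}(kerDenErase_{2N+2,2K+1})(2T)`, `tN/tD = g_K(−K+T)`: `L_N·D_H·tD = 2^A·L_D·N_H·tN` in `ℚ[T]`. -/
theorem frobenius_poly_two_hat :
    (taylor (-((2 * K + 1 : ℕ) : ℚ)) (kerNum A B 0 (2 * N + 2))).comp (C (2 : ℚ) * X) *
        (∏ i ∈ range (N + 1 + 1), (C (2 * (i : ℚ) - 1 - 2 * K) + C (2 : ℚ) * X)) ^ A *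
        taylor (-(K : ℚ)) (kerDenErase A N K) =
      C ((2 : ℚ) ^ A) * (taylor (-((2 * K + 1 : ℕ) : ℚ)) (kerDenErase A (2 * N + 2) (2 * K + 1))).comp (C (2 : ℚ) * X) *
        (C ((((N : ℚ) + 1) * ∏ i ∈ range (N + 1), (2 * (i : ℚ) + 1)) ^ (A - 2 * B)) *
          ((∏ i ∈ Icc 1 (N + 1), (C (-(2 * (K : ℚ)) - 2 * i - 1) + C (2 : ℚ) * X)) *
            ∏ i ∈ Icc 1 (N + 1), (C (-(2 * (K : ℚ)) + 2 * N + 2 * i + 1) + C (2 : ℚ) * X)) ^ B *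
          ((X - C ((K : ℚ) + N + 1)) * (X + C (((2 * N + 1 : ℕ) : ℚ) - K))) ^ B) *
        taylor (-(K : ℚ)) (kerNum A B 0 N) := by
  set LD := (taylor (-((2 * K + 1 : ℕ) : ℚ)) (kerDenErase A (2 * N + 2) (2 * K + 1))).comp (C (2 : ℚ) * X) with hLD
  set PD := (∏ i ∈ range (N + 1 + 1), (C (2 * (i : ℚ) - 1 - 2 * K) + C (2 : ℚ) * X)) ^ A with hPD
  set PN := C ((((N : ℚ) + 1) * ∏ i ∈ range (N + 1), (2 * (i : ℚ) + 1)) ^ (A - 2 * B)) *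
      ((∏ i ∈ Icc 1 (N + 1), (C (-(2 * (K : ℚ)) - 2 * i - 1) + C (2 : ℚ) * X)) *
        ∏ i ∈ Icc 1 (N + 1), (C (-(2 * (K : ℚ)) + 2 * N + 2 * i + 1) + C (2 : ℚ) * X)) ^ B *
      ((X - C ((K : ℚ) + N + 1)) * (X + C (((2 * N + 1 : ℕ) : ℚ) - K))) ^ B with hPN
  set tD := taylor (-(K : ℚ)) (kerDenErase A N K) with htD
  clear_value LD PD PN tD
  have hG : X * (LD * PD * tD) ≠ 0 := by
    refine mul_ne_zero X_ne_zero fun h => ?_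
    have h0 := congrArg (eval (0 : ℚ)) h
    rw [eval_mul, eval_mul, eval_zero] at h0
    rcases mul_eq_zero.1 h0 with h0 | h0
    · rcases mul_eq_zero.1 h0 with h0 | h0
      · rw [hLD, eval_comp, eval_mul, eval_C, eval_X, mul_zero, taylor_eval, zero_add] at h0
        exact eval_kerDenErase_neg_ne_zero A (2 * N + 2) (2 * K + 1) h0
      · rw [hPD] at h0
        have := eval_hatDen_ne_zero A N K 0
        rw [Int.cast_zero] at this
        exact this h0
    · rw [htD, taylor_eval, zero_add] at h0
      exact eval_kerDenErase_neg_ne_zero A N K h0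
  apply Polynomial.eq_of_infinite_eval_eq
  refine Set.Infinite.mono (s := {T : ℚ | ¬ (X * (LD * PD * tD)).IsRoot T}) (fun T hT => ?_)
    (Polynomial.finite_setOf_isRoot hG).infinite_compl
  have hT' : eval T (X * (LD * PD * tD)) ≠ 0 := hT
  rw [eval_mul, eval_mul, eval_mul, eval_X] at hT'
  have hT0 : T ≠ 0 := fun h => hT' (by rw [h, zero_mul])
  have hT1 : eval T LD ≠ 0 := fun h => hT' (by rw [h, zero_mul, zero_mul, mul_zero])
  have hT2 : eval T PD ≠ 0 := fun h => hT' (by rw [h, mul_zero, zero_mul, mul_zero])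
  have hT3 : eval T tD ≠ 0 := fun h => hT' (by rw [h, mul_zero, mul_zero])
  show eval T _ = eval T _
  have ht : -(K : ℚ) + T + K ≠ 0 := by rw [neg_add_cancel_comm]; exact hT0
  have hfun := topFun_two_even_row_odd hAB hK ht
  have e1 : topFun A B 0 (2 * N + 2) (2 * K + 1) (2 * (-(K : ℚ) + T) - 1) =
      ((taylor (-((2 * K + 1 : ℕ) : ℚ)) (kerNum A B 0 (2 * N + 2))).comp (C (2 : ℚ) * X)).eval T / LD.eval T := by
    rw [topFun_eq_div, hLD, eval_comp, eval_comp, eval_mul, eval_C, eval_X, taylor_eval, taylor_eval]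
    congr 2 <;> (push_cast; ring)
  have e2 := hat_eval A B N K T
  rw [← hPN, ← hPD] at e2
  have e3 : topFun A B 0 N K (-(K : ℚ) + T) = (taylor (-(K : ℚ)) (kerNum A B 0 N)).eval T / tD.eval T := by
    rw [topFun_eq_div, htD, taylor_eval, taylor_eval, add_comm]
  rw [e1, ← e2, e3, div_eq_iff hT1] at hfun
  rw [eval_mul, eval_mul, hfun, eval_mul, eval_mul, eval_mul, eval_C]
  field_simp

/-- **The hat identity as power series**: `rescale₂(F^{(2N+2)}_{2K+1}) = C(2^A)·(N_H/D_H)·F^{(N)}_K` in `ℚ⟦T⟧`,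
i.e. `F^{(2N+2)}_{2K+1}(2T) = 2^A·Ĥ_N(−K+T)·((T−K−N−1)(T−K+2N+1))^B·F^{(N)}_K(T)`. -/
theorem laurentSeries_two_hat :
    PowerSeries.rescale (2 : ℚ) (laurentSeries A B 0 (2 * N + 2) (2 * K + 1)) =
      PowerSeries.C ((2 : ℚ) ^ A) *
        expandAt 0 (C ((((N : ℚ) + 1) * ∏ i ∈ range (N + 1), (2 * (i : ℚ) + 1)) ^ (A - 2 * B)) *
            ((∏ i ∈ Icc 1 (N + 1), (C (-(2 * (K : ℚ)) - 2 * i - 1) + C (2 : ℚ) * X)) *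
              ∏ i ∈ Icc 1 (N + 1), (C (-(2 * (K : ℚ)) + 2 * N + 2 * i + 1) + C (2 : ℚ) * X)) ^ B *
            ((X - C ((K : ℚ) + N + 1)) * (X + C (((2 * N + 1 : ℕ) : ℚ) - K))) ^ B)
          ((∏ i ∈ range (N + 1 + 1), (C (2 * (i : ℚ) - 1 - 2 * K) + C (2 : ℚ) * X)) ^ A) *
        laurentSeries A B 0 N K := by
  have hpoly := congrArg (fun P : ℚ[X] => (P : PowerSeries ℚ)) (frobenius_poly_two_hat hAB hK)
  set PNp : ℚ[X] := C ((((N : ℚ) + 1) * ∏ i ∈ range (N + 1), (2 * (i : ℚ) + 1)) ^ (A - 2 * B)) *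
      ((∏ i ∈ Icc 1 (N + 1), (C (-(2 * (K : ℚ)) - 2 * i - 1) + C (2 : ℚ) * X)) *
        ∏ i ∈ Icc 1 (N + 1), (C (-(2 * (K : ℚ)) + 2 * N + 2 * i + 1) + C (2 : ℚ) * X)) ^ B *
      ((X - C ((K : ℚ) + N + 1)) * (X + C (((2 * N + 1 : ℕ) : ℚ) - K))) ^ B with hPNp
  set PDp : ℚ[X] := (∏ i ∈ range (N + 1 + 1), (C (2 * (i : ℚ) - 1 - 2 * K) + C (2 : ℚ) * X)) ^ A with hPDp
  clear_value PNp PDp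
  simp only [Polynomial.coe_mul, coe_comp_C_mul_X, Polynomial.coe_C] at hpoly
  set LN := PowerSeries.rescale (2 : ℚ) ((taylor (-((2 * K + 1 : ℕ) : ℚ)) (kerNum A B 0 (2 * N + 2)) : ℚ[X]) :
    PowerSeries ℚ) with hLN
  set LD := PowerSeries.rescale (2 : ℚ) ((taylor (-((2 * K + 1 : ℕ) : ℚ)) (kerDenErase A (2 * N + 2) (2 * K + 1)) : ℚ[X]) :
    PowerSeries ℚ) with hLD
  set PN := ((PNp : ℚ[X]) : PowerSeries ℚ) with hPN
  set PD := ((PDp : ℚ[X]) : PowerSeries ℚ) with hPD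
  set tN := ((taylor (-(K : ℚ)) (kerNum A B 0 N) : ℚ[X]) : PowerSeries ℚ) with htN
  set tD := ((taylor (-(K : ℚ)) (kerDenErase A N K) : ℚ[X]) : PowerSeries ℚ) with htD
  have hLD0 : PowerSeries.constantCoeff LD ≠ 0 := by
    rw [hLD, ← PowerSeries.coeff_zero_eq_constantCoeff_apply, PowerSeries.coeff_rescale, pow_zero, one_mul,
      PowerSeries.coeff_zero_eq_constantCoeff_apply, constantCoeff_coe_taylor]
    exact eval_kerDenErase_neg_ne_zero A (2 * N + 2) (2 * K + 1)
  have hPD0 : PowerSeries.constantCoeff PD ≠ 0 := by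
    rw [hPD, hPDp, Polynomial.constantCoeff_coe, coeff_zero_eq_eval_zero]
    have := eval_hatDen_ne_zero A N K 0
    rwa [Int.cast_zero] at this
  have htD0 : PowerSeries.constantCoeff tD ≠ 0 := by
    rw [htD, constantCoeff_coe_taylor]; exact eval_kerDenErase_neg_ne_zero A N K
  have hL : PowerSeries.rescale (2 : ℚ) (laurentSeries A B 0 (2 * N + 2) (2 * K + 1)) = LN * LD⁻¹ := by
    rw [laurentSeries, expandAt, map_mul, rescale_inv _ (by
      rw [constantCoeff_coe_taylor]; exact eval_kerDenErase_neg_ne_zero A (2 * N + 2) (2 * K + 1))]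
  have hΨ : expandAt 0 PNp PDp = PN * PD⁻¹ := by
    rw [expandAt, taylor_zero, taylor_zero]
  have hR : laurentSeries A B 0 N K = tN * tD⁻¹ := rfl
  rw [hL, hΨ, hR]
  have hne : LD * PD * tD ≠ 0 := by
    refine mul_ne_zero (mul_ne_zero ?_ ?_) ?_ <;> intro h <;> [apply hLD0; apply hPD0; apply htD0] <;>
      rw [h, map_zero]
  apply mul_right_cancel₀ hne
  calc LN * LD⁻¹ * (LD * PD * tD) = LN * PD * tD * (LD⁻¹ * LD) := by ring
    _ = LN * PD * tD := by rw [PowerSeries.inv_mul_cancel _ hLD0, mul_one]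
    _ = PowerSeries.C ((2 : ℚ) ^ A) * LD * PN * tN := hpoly
    _ = PowerSeries.C ((2 : ℚ) ^ A) * LD * PN * tN * (PD⁻¹ * PD) * (tD⁻¹ * tD) := by
        rw [PowerSeries.inv_mul_cancel _ hPD0, PowerSeries.inv_mul_cancel _ htD0, mul_one, mul_one]
    _ = PowerSeries.C ((2 : ℚ) ^ A) * (PN * PD⁻¹) * (tN * tD⁻¹) * (LD * PD * tD) := by ring

/-- **The hat identity at every depth**: for `2B ≤ A`, `K ≤ N`, every `d`:
`2^d·laurent(2N+2, 2K+1, d) = 2^A·Σ_{(m,e) ∈ antidiagonal d} h_m·laurent(N, K, e)`, `h_m = [T^m](N_H/D_H)`. -/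
theorem laurent_two_hat (d : ℕ) :
    (2 : ℚ) ^ d * laurent A B 0 (2 * N + 2) (2 * K + 1) d =
      (2 : ℚ) ^ A * ∑ x ∈ antidiagonal d,
        PowerSeries.coeff x.1 (expandAt 0 (C ((((N : ℚ) + 1) * ∏ i ∈ range (N + 1), (2 * (i : ℚ) + 1)) ^ (A - 2 * B)) *
            ((∏ i ∈ Icc 1 (N + 1), (C (-(2 * (K : ℚ)) - 2 * i - 1) + C (2 : ℚ) * X)) *
              ∏ i ∈ Icc 1 (N + 1), (C (-(2 * (K : ℚ)) + 2 * N + 2 * i + 1) + C (2 : ℚ) * X)) ^ B *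
            ((X - C ((K : ℚ) + N + 1)) * (X + C (((2 * N + 1 : ℕ) : ℚ) - K))) ^ B)
          ((∏ i ∈ range (N + 1 + 1), (C (2 * (i : ℚ) - 1 - 2 * K) + C (2 : ℚ) * X)) ^ A)) *
          laurent A B 0 N K x.2 := by
  have h := congrArg (PowerSeries.coeff d) (laurentSeries_two_hat hAB hK)
  rw [PowerSeries.coeff_rescale, mul_assoc, PowerSeries.coeff_C_mul, PowerSeries.coeff_mul] at h
  simpa only [laurent] using h

/-- **The hat identity in cell indexing** (`1 ≤ s ≤ A`): `2^{A−s}·c_{2K+1,s}(2N+2) = 2^A·Σ_{m=0}^{A−s} h_m·c_{K,s+m}(N)`. -/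
theorem cell_two_hat (s : ℕ) :
    (2 : ℚ) ^ (A - s) * cell A B 0 (2 * N + 2) (2 * K + 1) s =
      (2 : ℚ) ^ A * ∑ m ∈ range (A - s + 1),
        PowerSeries.coeff m (expandAt 0 (C ((((N : ℚ) + 1) * ∏ i ∈ range (N + 1), (2 * (i : ℚ) + 1)) ^ (A - 2 * B)) *
            ((∏ i ∈ Icc 1 (N + 1), (C (-(2 * (K : ℚ)) - 2 * i - 1) + C (2 : ℚ) * X)) *
              ∏ i ∈ Icc 1 (N + 1), (C (-(2 * (K : ℚ)) + 2 * N + 2 * i + 1) + C (2 : ℚ) * X)) ^ B *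
            ((X - C ((K : ℚ) + N + 1)) * (X + C (((2 * N + 1 : ℕ) : ℚ) - K))) ^ B)
          ((∏ i ∈ range (N + 1 + 1), (C (2 * (i : ℚ) - 1 - 2 * K) + C (2 : ℚ) * X)) ^ A)) *
          cell A B 0 N K (s + m) := by
  rw [cell, laurent_two_hat hAB hK (A - s), Finset.Nat.sum_antidiagonal_eq_sum_range_succ_mk]
  congr 1
  refine Finset.sum_congr rfl fun m _ => ?_
  rw [cell, Nat.sub_add_eq]

end frobenius

/-! ## The multiplier series is `2`-integral -/

section arithmetic

/-- `N_H ∈ ℤ_(2)[T]`. -/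
theorem isSlopeInt_hatNum (A B N K : ℕ) :
    IsSlopeInt 2 0 0 ((C ((((N : ℚ) + 1) * ∏ i ∈ range (N + 1), (2 * (i : ℚ) + 1)) ^ (A - 2 * B)) *
      ((∏ i ∈ Icc 1 (N + 1), (C (-(2 * (K : ℚ)) - 2 * i - 1) + C (2 : ℚ) * X)) *
        ∏ i ∈ Icc 1 (N + 1), (C (-(2 * (K : ℚ)) + 2 * N + 2 * i + 1) + C (2 : ℚ) * X)) ^ B *
      ((X - C ((K : ℚ) + N + 1)) * (X + C (((2 * N + 1 : ℕ) : ℚ) - K))) ^ B : ℚ[X]) : PowerSeries ℚ) := by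
  haveI : Fact (Nat.Prime 2) := ⟨Nat.prime_two⟩
  rw [Polynomial.coe_mul, Polynomial.coe_mul]
  have h1 : IsSlopeInt 2 0 0 ((C ((((N : ℚ) + 1) * ∏ i ∈ range (N + 1), (2 * (i : ℚ) + 1)) ^ (A - 2 * B)) : ℚ[X]) : PowerSeries ℚ) := by
    have hc : ((((((N : ℤ) + 1) * ∏ i ∈ range (N + 1), (2 * (i : ℤ) + 1)) ^ (A - 2 * B) : ℤ)) : ℚ) =
        (((N : ℚ) + 1) * ∏ i ∈ range (N + 1), (2 * (i : ℚ) + 1)) ^ (A - 2 * B) := by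
      rw [Int.cast_pow, Int.cast_mul, Int.cast_prod]
      congr 2
      · push_cast; ring
      · exact Finset.prod_congr rfl fun i _ => by push_cast; ring
    rw [Polynomial.coe_C, ← hc]
    refine isSlopeInt_C 0 ?_
    rw [exp_zero, Rat.padicValuation_cast]
    exact Int.padicValuation_le_one 2 _
  have h2 : IsSlopeInt 2 0 0 ((((∏ i ∈ Icc 1 (N + 1), (C (-(2 * (K : ℚ)) - 2 * i - 1) + C (2 : ℚ) * X)) *
      ∏ i ∈ Icc 1 (N + 1), (C (-(2 * (K : ℚ)) + 2 * N + 2 * i + 1) + C (2 : ℚ) * X)) ^ B : ℚ[X]) : PowerSeries ℚ) := by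
    refine isSlopeInt_coe_pow _ ?_ B
    rw [Polynomial.coe_mul]
    have ha := isSlopeInt_coe_prod (p := 2) (Icc 1 (N + 1)) (fun i => C (-(2 * (K : ℚ)) - 2 * i - 1) + C (2 : ℚ) * X)
      (w := 0) fun i _ => isSlopeInt_two_linear (-(2 * (K : ℤ)) - 2 * i - 1) (-(2 * (K : ℚ)) - 2 * i - 1) (by push_cast; ring)
    have hb := isSlopeInt_coe_prod (p := 2) (Icc 1 (N + 1))
      (fun i => C (-(2 * (K : ℚ)) + 2 * N + 2 * i + 1) + C (2 : ℚ) * X) (w := 0) fun i _ =>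
        isSlopeInt_two_linear (-(2 * (K : ℤ)) + 2 * N + 2 * i + 1) (-(2 * (K : ℚ)) + 2 * N + 2 * i + 1)
          (by push_cast; ring)
    have h := isSlopeInt_mul ha hb
    rwa [add_zero] at h
  have h3 : IsSlopeInt 2 0 0 ((((X - C ((K : ℚ) + N + 1)) * (X + C (((2 * N + 1 : ℕ) : ℚ) - K))) ^ B : ℚ[X]) :
      PowerSeries ℚ) := by
    have e : (((X - C ((K + N + 1 : ℕ) : ℤ)) * (X + C (((2 * N + 1 : ℕ) : ℤ) - K))) ^ B).map (Int.castRingHom ℚ) =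
        ((X - C ((K : ℚ) + N + 1)) * (X + C (((2 * N + 1 : ℕ) : ℚ) - K))) ^ B := by
      rw [Polynomial.map_pow, Polynomial.map_mul, Polynomial.map_sub, Polynomial.map_add, map_X, Polynomial.map_C,
        Polynomial.map_C, eq_intCast, eq_intCast, Int.cast_natCast, Nat.cast_add, Nat.cast_add, Nat.cast_one, Int.cast_sub,
        Int.cast_natCast, Int.cast_natCast]
    rw [← e]; exact isSlopeInt_coe_map_int _
  have h := isSlopeInt_mul (isSlopeInt_mul h1 h2) h3
  rwa [add_zero, add_zero] at h

/-- `D_H ∈ ℤ_(2)[T]`. -/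
theorem isSlopeInt_hatDen (A N K : ℕ) :
    IsSlopeInt 2 0 0 (((∏ i ∈ range (N + 1 + 1), (C (2 * (i : ℚ) - 1 - 2 * K) + C (2 : ℚ) * X)) ^ A : ℚ[X]) :
      PowerSeries ℚ) := by
  haveI : Fact (Nat.Prime 2) := ⟨Nat.prime_two⟩
  refine isSlopeInt_coe_pow _ ?_ A
  exact isSlopeInt_coe_prod (p := 2) (range (N + 1 + 1)) (fun i => C (2 * (i : ℚ) - 1 - 2 * K) + C (2 : ℚ) * X) (w := 0)
    fun i _ => isSlopeInt_two_linear (2 * (i : ℤ) - 1 - 2 * K) (2 * (i : ℚ) - 1 - 2 * K) (by push_cast; ring)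

/-- `D_H(0) = ∏_{i≤N+1}(2i−1−2K)^A` is a `2`-adic unit (every factor is odd). -/
theorem padicValuation_constantCoeff_hatDen (A N K : ℕ) :
    @Rat.padicValuation 2 ⟨Nat.prime_two⟩ (PowerSeries.constantCoeff
      (((∏ i ∈ range (N + 1 + 1), (C (2 * (i : ℚ) - 1 - 2 * K) + C (2 : ℚ) * X)) ^ A : ℚ[X]) : PowerSeries ℚ)) = 1 := by
  haveI : Fact (Nat.Prime 2) := ⟨Nat.prime_two⟩
  have hfac : ∀ i ∈ range (N + 1 + 1),
      Rat.padicValuation 2 ((C (2 * (i : ℚ) - 1 - 2 * K) + C (2 : ℚ) * X).eval 0) = 1 := fun i _ => by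
    rw [eval_add, eval_mul, eval_C, eval_C, eval_X, mul_zero, add_zero,
      show (2 * (i : ℚ) - 1 - 2 * K) = ((2 * (i : ℤ) - 1 - 2 * K : ℤ) : ℚ) by push_cast; ring, Rat.padicValuation_cast,
      Int.padicValuation_eq_one_iff]
    rintro ⟨c, hc⟩
    push_cast at hc
    omega
  rw [Polynomial.constantCoeff_coe, coeff_zero_eq_eval_zero, eval_pow, eval_prod, map_pow, map_prod,
    Finset.prod_eq_one hfac, one_pow]

/-- **`h_m ∈ ℤ_(2)` for every `m`**: `H = N_H/D_H ∈ ℤ_(2)⟦T⟧` (`N_H`, `D_H` `2`-integral, `D_H(0)` odd). -/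
theorem isSlopeInt_hatSeries (A B N K : ℕ) :
    IsSlopeInt 2 0 0 (expandAt 0 (C ((((N : ℚ) + 1) * ∏ i ∈ range (N + 1), (2 * (i : ℚ) + 1)) ^ (A - 2 * B)) *
            ((∏ i ∈ Icc 1 (N + 1), (C (-(2 * (K : ℚ)) - 2 * i - 1) + C (2 : ℚ) * X)) *
              ∏ i ∈ Icc 1 (N + 1), (C (-(2 * (K : ℚ)) + 2 * N + 2 * i + 1) + C (2 : ℚ) * X)) ^ B *
            ((X - C ((K : ℚ) + N + 1)) * (X + C (((2 * N + 1 : ℕ) : ℚ) - K))) ^ B)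
          ((∏ i ∈ range (N + 1 + 1), (C (2 * (i : ℚ) - 1 - 2 * K) + C (2 : ℚ) * X)) ^ A)) := by
  haveI : Fact (Nat.Prime 2) := ⟨Nat.prime_two⟩
  have h := isSlopeInt_mul (isSlopeInt_hatNum A B N K)
    (isSlopeInt_inv (isSlopeInt_hatDen A N K) (padicValuation_constantCoeff_hatDen A N K))
  rw [add_zero] at h
  rw [expandAt, taylor_zero, taylor_zero]
  exact h

/-- **The hole cells are `2^A` times `2`-integral data on the row below**: for `2B ≤ A`, `K ≤ N` and any bound `b` with
`v₂(laurent(N, K, e)) ≤ b` for all `e ≤ d`:  `v₂(2^d·laurent(2N+2, 2K+1, d)) ≤ 2^{−A}·b`. -/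
theorem padicValuation_pow_mul_laurent_two_hat {A B : ℕ} (hAB : 2 * B ≤ A) {N K : ℕ} (hK : K ≤ N) (d : ℕ)
    {b : ℤᵐ⁰} (hb : ∀ e, e ≤ d → @Rat.padicValuation 2 ⟨Nat.prime_two⟩ (laurent A B 0 N K e) ≤ b) :
    @Rat.padicValuation 2 ⟨Nat.prime_two⟩ ((2 : ℚ) ^ d * laurent A B 0 (2 * N + 2) (2 * K + 1) d) ≤
      exp (-(A : ℤ)) * b := by
  haveI : Fact (Nat.Prime 2) := ⟨Nat.prime_two⟩
  have hw := isSlopeInt_hatSeries A B N K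
  rw [laurent_two_hat hAB hK d, map_mul, map_pow, show (2 : ℚ) = ((2 : ℕ) : ℚ) by norm_num, Rat.padicValuation_self,
    ← exp_nsmul, nsmul_eq_mul, mul_neg_one]
  refine mul_le_mul' le_rfl (Valuation.map_sum_le _ fun x hx => ?_)
  rw [map_mul]
  have h1 := hw x.1
  rw [zero_mul, zero_add, exp_zero] at h1
  calc _ ≤ 1 * b := mul_le_mul' h1 (hb x.2 (by have := mem_antidiagonal.1 hx; omega))
    _ = b := one_mul b

end arithmetic

end

end Summit.KontsevichZagierPeriods.Zeta5Search.BrickHatTwoCells
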